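import Summits.ResolutionOfSingularities.ResolutionOfSingularities.Theorems.NoJumpOrderQ
import HarnessLib

/-!
# NoJump — decomp-res lens-5 («finite/base range + asymptotic regime + bridge»), generation 14

(decomp-res node N70 «NoJump ∥ JumpCut», PROOF NODE: lens-5 g14 `NoJump.lean` sha256 05b2bacbf18a7deb, critic
row 88 CLEARED —
item 31871 `MaxContactCut.ICNoRecurrentJumpDeep` PROVED BY NAME (`icNoRecurrentJumpDeep_holds`); convergent
independent proof lens-3 g13
`JumpCut` (row 89, co-credit; its MAP delta lands separately as `Theorems/JumpCutClasses.lean` rebased on this file).)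

[WRITER NOTE (decomp-res writer g5).  Lens file VERBATIM, split in two for the 400-line limit (§1 =
`Theorems.NoJumpOrderQ`, imported; §§2–4 here); only the lens's out-of-tree dupNamespace linter
option line is dropped (tree convention).  This is a BY-NAME file: it imports the route cone through `Theorems.MaxContactCutItineraryCut`
because it proves a route item by name.  TREE: 31871 PROVED; 31770 `DefectWalksDeep` ⟺ 31870-class `NoPlateauWalksDeep`
(`defectWalksDeep_iff_noPlateau`); located residual of the cell = ONE: «subcritical plateau ∧ translation-recurrent»
(critic g3 final).  Operator ask: `ledger workitem close stmt-ResolutionOfSingularities-31871 --as proved --by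
Summit.ResolutionOfSingularities.ResolutionOfSingularities.Theorems.NoJump.icNoRecurrentJumpDeep_holds` if the gate does not
match it automatically.]

RESIDUAL MODE on the live route `MaxContactCut`, host piece BY NAME: the aside `MaxContactCut.ICNoRecurrentJumpDeep`
(`= ItineraryCutClasses.NoRecurrentJumpWalksDeep`, `Iff.rfl`, tree `MaxContactCutItineraryCut.icNoRecurrentJumpDeep_iff`),
the «jump half» of item 31770 `MaxContactCut.DefectWalksDeep` (`= TightDefectClasses.DefectWalksTerminateDeep`) under the
tree equivalence `ItineraryCutClasses.defectDeep_iff : DefectWalksTerminateDeep ↔ NoPlateauWalksDeep ∧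
NoRecurrentJumpWalksDeep`.

## THE RESULT (PROVED, 0 sorry): forced walks from a root never jump

`shade_succ_le_shade` — for every prime `p`, every `e`, every field `K` of characteristic `p`, every ROOT `s₀`
(`r = 0`, cleaned, `ord ≥ q = pᵉ`) and every forced walk `W : ForcedWalk (p^e) s₀` of the tree's E-model
(`TightDefectClasses.ForcedWalk`: point blow-ups at equimultiple points of the new exceptional divisor, the origin an
ISOLATED point of the top locus at every stage):

  `(W.st (n+1)).shade ≤ (W.st n).shade` for every `n`.

Hence `noRecurrentJumpWalksDeep_holds : NoRecurrentJumpWalksDeep`, `icNoRecurrentJumpDeep_holds :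
MaxContactCut.ICNoRecurrentJumpDeep` (a route item CLOSES), and THE CUT of this node (EXACT, by name):

  `defectWalksDeep_iff_noPlateau : MaxContactCut.DefectWalksDeep ↔ NoPlateauWalksDeep`

— the summit-strength residual 31770 IS the plateau class: «no infinite forced deep walk of eventually constant positive
shade». Moreover along every forced walk from a root the shade is ANTITONE (`shade_antitone`) and eventually constant
(`shade_eventuallyStalls`), and the order stays in the window `q ≤ ord (W.st t).F < 2q` (`order_lt_two_mul`).

## THE PROOF (the lens-5 triad, read on the ORDER axis: base range `o = q` · range `o ≥ 2q` · bridge `q ∣ o`)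

* (J1) ORDER CEILING `o_t < 2q` (§2, `order_lt_two_mul`): the new exceptional component created at step `t` has
  multiplicity `r_{t+1}(j_t) = o_t − q` (tree `BoundaryLedger.r_succ_eq`), and at the ISOLATED state `t+1` every pair of
  multiplicities sums to `< q` (tree `TightDefectStrongWalks.pair_lt_of_isolatedTop`, `X_pow_mul_X_pow_dvd_of_forall_le`,
  `ItineraryCutClasses.walk_r`).  [The «asymptotic range» `o ≥ 2q` of Hauser–Perlega's kangaroo points is EMPTY along
  forced walks: after a blow-up at order `≥ 2q` the new exceptional multiplicity is `≥ q`, `u_j^q ∣ F′`, and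
the top locus
  contains the surface `{z = u_j = 0}` — Hauser–Perlega 2019 Comment (b): «the center `Z′ = V(z, x₁)` …
can be blown up»;
  the point blow-up is no longer forced.]
* (J2) BRIDGE `q ∣ o_t` at a jump (tree `PointBlowup.necessary_of_shadeIncreases_pow` (i) = [HauserPerlega2019, §3 Thm (2)],
  [Moh1987]); with (J1) and `o_t ≥ q`: a jump can only happen at ORDER EXACTLY `q`.
* (J3) BASE RANGE `o = q` — THE NEW LEMMA (§1, `not_isEquimultiplePoint_of_ordZero_eq`, every dimension, every `q ≥ 1`,
  every field): if `F` is cleaned of `q`-th powers, `ord F = q` EXACTLY, and `u_i ∣ F` for some `i ≠ j`, then NO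
point `b` of
  the `u_j`-chart with `b_j = 0`, `b_i ≠ 0` is equimultiple.  Proof: the `u_j`-free layer of the point transform is
  `g̃ = g(u + b)` with `g = in(F)(u_j := 1)` (only the initial monomials reach `u_j`-exponent `|d| − q = 0`), a polynomial of
  degree `≤ q`; equimultiplicity makes `g̃ = c + Q` with `Q` its degree-`q` part; substituting `u_i := −b_i` kills `g̃`
  (because `u_i ∣ g`), whence every degree-`q` coefficient of `g̃` off `u_i^q` vanishes and `c = −Q₀(−b_i)^q`; but the
  coefficient of `u_i^q` in `g̃` is the coefficient of the `q`-th power `u_i^q` in the CLEANED `F`, i.e. `0`; so `g̃ = 0`,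
  `g = g̃(u − b) = 0`, and an initial monomial of `F` has coefficient `0` — absurd.
* (J4) A jump LOSES an old exceptional component: some `i₀ ≠ j_t` with `b_t i₀ ≠ 0` and `r_t i₀ ≥ 1` (tree
  `necessary_of_shadeIncreases_pow` (iii) = [HauserPerlega2019, §3 Thm (7) + Comment (d)]); along a walk from a root
  `u^{r_t} ∣ F_t` (`walk_r`), so `u_{i₀} ∣ F_t`, and (J3) at `o_t = q` says the point `b_t` is not equimultiple —
  contradicting `W.equimult t`.  ∎

## Pieces and tags (critic format)

  Target (BY NAME) `MaxContactCut.DefectWalksDeep` (31770)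
    ⟸ `NoPlateauWalksDeep` [EXACT = EQUIVALENT (`defectWalksDeep_iff_noPlateau`) · UNDECIDED · the ONE booked residual
       «plateau»; by `shade_eventuallyStalls` EVERY infinite forced deep walk is eventually a plateau, so nothing else
       remains on the E-model side; its translation-free part dies by lens-3's `noOriginTails_holds` + `noCornerTowers_tree`
       (ProximityCut rev 3), so the LIVE residual is «plateau ∧ translation-recurrent» (cn16 COORDINATION: ONE residual)]
    ∧ `NoRecurrentJumpWalksDeep` [DECIDED — PROVED here (`noRecurrentJumpWalksDeep_holds`); was UNDECIDED·IDEA-NEEDED in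
       tree `ItineraryCutClasses` :291 and aside `MaxContactCut.ICNoRecurrentJumpDeep`].
  Kernels PROVED: `not_isEquimultiplePoint_of_ordZero_eq` (J3), `r_succ_chart`, `order_lt_two_mul` (J1),
  `shade_succ_le_shade`, `not_jumpAt`, `not_recurrentJumps`, `shade_antitone`, `shade_eventuallyStalls`,
  `noRecurrentJumpWalksDeep_holds`, `icNoRecurrentJumpDeep_holds`, `noRecurrentBoundaryJumpWalksDeep_holds`,
  `defectDeep_iff_noPlateau`, `defectWalksDeep_iff_noPlateau`, `defectWalksDeep_iff_icNoPlateau`.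

WHY NOVEL (one sentence): the cell's census (T-forced-jump-1, 0 forced jumps / 187 170) and critic note cn16 looked for
the obstruction at the PARENT («heavy pair or top axis»), which is false as a statement about states (an isolated, light,
axis-free jump parent exists: `q = 4`, `F = xyz⁷+xy⁷+x²y⁶+x³y⁵+x⁵y³+x⁶y²+x⁷y+x¹⁴y`, `r =
(1,1,0)`, chart `x`, `b = (0,1,0)`,
shade `6 → 7`; lens-5 g14 scratch/iso2.py), whereas the true obstruction is the CHILD's isolation (J1) plus the order-`q`
rigidity (J3), neither of which is in the tree, in [Hauser2010]/[HauserPerlega2019]/[Moh1987] (who do not work under the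
isolated-top-locus constraint), or in any cell node (ItineraryCut, BoundaryLedger, LassoCut, HugDimension, ProximityCut
list the jump half as UNDECIDED).
WHY STRICTLY WEAKER / EXACT: nothing weaker is claimed — the jump half is DECIDED (true), and the cut `31770 ⟺
NoPlateauWalksDeep`
is an equivalence proved in the tree's own terms.

Self-check: `lean check` rc 0, 0 sorry; imports = tree `Theorems.BoundaryLedgerModel`, `Theorems.MaxContactCutItineraryCut`
+ HarnessLib only.  (Sources: Hauser2010 §§D,F,G; HauserPerlega2019 §3 Theorem (2),(7), Comments (b),(d); Moh1987 §1.)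
-/


noncomputable section

open MvPolynomial Finset
open scoped BigOperators
open Literature.AlgebraicGeometry.Resolution
open Literature.AlgebraicGeometry.Resolution.Hauser2010
open Literature.AlgebraicGeometry.Resolution.PointBlowup
open Literature.AlgebraicGeometry.Resolution.WeightedBlowup
open Literature.Barriers.ResolutionOfSingularities
open Summit.ResolutionOfSingularities.ResolutionOfSingularities.Theses
open Summit.ResolutionOfSingularities.ResolutionOfSingularities.Theorems.TightDefectClasses
open Summit.ResolutionOfSingularities.ResolutionOfSingularities.Theorems.TightDefectStrongWalks
open Summit.ResolutionOfSingularities.ResolutionOfSingularities.Theorems.ItineraryCutClasses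
open Summit.ResolutionOfSingularities.ResolutionOfSingularities.Theorems.BoundaryLedger

namespace Summit.ResolutionOfSingularities.ResolutionOfSingularities.Theorems.NoJump

/-! ## §2 The order ceiling `o_t < 2q` along a forced walk from a root (any `q`) -/

section Walk

variable {K : Type} [Field K] [DecidableEq K] {q : ℕ} {s₀ : State (Fin 3) K}

/-- The new exceptional component has multiplicity `o_t − q` (tree ledger `r_succ_eq`, read at the chart index).
[folklore] (Sources: Hauser2010 §D.) -/
theorem r_succ_chart (W : ForcedWalk q s₀) (t : ℕ) {o : ℕ} (ho : ordZero (W.st t).F = o) :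
    (W.st (t + 1)).r (W.j t) = o - q := by
  classical
  rw [r_succ_eq W t ho, Finsupp.add_apply, kept_apply, if_neg (fun h => h.1 rfl), Finsupp.single_eq_same, zero_add]

/-- **(J1) ORDER CEILING (PROVED): `q ≤ ord F_t < 2q` along every forced walk from a root.**  The new component's
multiplicity `o_t − q` pairs with any other multiplicity to `< q` at the ISOLATED state `t+1`
(`pair_lt_of_isolatedTop`).  [new] (Sources: Hauser2010 §§D,G; HauserPerlega2019 §3 Comment (b).) -/
theorem order_lt_two_mul (hroot : IsRoot q s₀) (W : ForcedWalk q s₀) (t : ℕ) :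
    ∃ o : ℕ, ordZero (W.st t).F = o ∧ q ≤ o ∧ o < 2 * q := by
  classical
  obtain ⟨o, ho, hqo⟩ := walk_nat hroot W t
  refine ⟨o, ho, hqo, ?_⟩
  obtain ⟨k, hk⟩ := exists_ne (W.j t)
  have hlt := pair_lt_of_isolatedTop (W.isolated (t + 1)) (W.j t) k hk.symm
    (X_pow_mul_X_pow_dvd_of_forall_le (walk_r hroot W (t + 1)) hk.symm)
  rw [r_succ_chart W t ho] at hlt
  omega

/-- The order window in `ℕ∞` form. [new] [folklore] -/
theorem ordZero_lt_two_mul (hroot : IsRoot q s₀) (W : ForcedWalk q s₀) (t : ℕ) :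
    ordZero (W.st t).F < ((2 * q : ℕ) : ℕ∞) := by
  obtain ⟨o, ho, -, h2⟩ := order_lt_two_mul hroot W t
  rw [ho]
  exact_mod_cast h2

/-- Consequently the new exceptional multiplicity is always `< q`. [new] [folklore] -/
theorem r_succ_chart_lt (hroot : IsRoot q s₀) (W : ForcedWalk q s₀) (t : ℕ) :
    (W.st (t + 1)).r (W.j t) < q := by
  obtain ⟨o, ho, hqo, h2⟩ := order_lt_two_mul hroot W t
  rw [r_succ_chart W t ho]
  omega

end Walk

/-! ## §3 No jump along a forced walk from a root (`q = pᵉ`) -/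

section Jumps

variable {p e : ℕ} {K : Type} [Field K] [CharP K p] [DecidableEq K] {s₀ : State (Fin 3) K}

/-- **NO JUMP (PROVED): along a forced walk from a root the shade never increases.**  (J2) a jump needs `q ∣ o_t`
(tree `necessary_of_shadeIncreases_pow` (i)), so `o_t = q` by (J1); (J4) it loses an old component `i₀` with
`r_t i₀ ≥ 1` (ibid. (iii)), so `u_{i₀} ∣ F_t` (`walk_r`); (J3) forbids an equimultiple point there.  [new]
(Sources: HauserPerlega2019 §3 Theorem (2), (7), Comments (b), (d); Moh1987 §1; Hauser2010 §F.) -/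
theorem shade_succ_le_shade (hp : p.Prime) (hroot : IsRoot (p ^ e) s₀) (W : ForcedWalk (p ^ e) s₀) (n : ℕ) :
    (W.st (n + 1)).shade ≤ (W.st n).shade := by
  classical
  haveI : Fact p.Prime := ⟨hp⟩
  by_contra hlt
  rw [not_le] at hlt
  have hinc : ShadeIncreases (p ^ e) (W.j n) (W.b n) (W.st n) := by
    unfold ShadeIncreases
    rw [← W.st_succ]
    exact hlt
  obtain ⟨o, ho, hqo, ho2⟩ := order_lt_two_mul hroot W n
  obtain ⟨hdvd, -, i₀, hi₀j, hbi₀, hri₀, -⟩ :=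
    necessary_of_shadeIncreases_pow p (W.j n) (W.b n) (W.onExc n) (W.st n) (walk_clean hroot W n) ho hqo
      (walk_r hroot W n) hinc
  have hq : 0 < p ^ e := Nat.pos_of_ne_zero (pow_ne_zero e hp.ne_zero)
  have hoq : o = p ^ e := by
    obtain ⟨c, hc⟩ := hdvd
    have h1 : p ^ e * c < p ^ e * 2 := by rw [← hc]; omega
    have hc2 : c < 2 := Nat.lt_of_mul_lt_mul_left h1
    have hc1 : c ≠ 0 := by
      rintro rfl
      rw [mul_zero] at hc
      omega
    have : c = 1 := by omega
    rw [hc, this, mul_one]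
  have hdi : ∀ d ∈ (W.st n).F.support, 1 ≤ d i₀ := by
    intro d hd
    have h1 := Finsupp.le_def.mp (walk_r hroot W n d hd) i₀
    have h2 : 1 ≤ (W.st n).r i₀ := Nat.pos_of_ne_zero hri₀
    omega
  exact not_isEquimultiplePoint_of_ordZero_eq (W.j n) (W.b n) (W.onExc n) (W.st n) (walk_clean hroot W n)
    (by rw [ho, hoq]) hi₀j hbi₀ hdi (W.equimult n)

/-- No jump at any time (itinerary form). [new] [folklore] -/
theorem not_jumpAt (hp : p.Prime) (hroot : IsRoot (p ^ e) s₀) (W : ForcedWalk (p ^ e) s₀) (n : ℕ) :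
    ¬ JumpAt (fun i => (W.st i).shade) n :=
  not_lt.mpr (shade_succ_le_shade hp hroot W n)

/-- No recurrent jumps. [new] [folklore] -/
theorem not_recurrentJumps (hp : p.Prime) (hroot : IsRoot (p ^ e) s₀) (W : ForcedWalk (p ^ e) s₀) :
    ¬ RecurrentJumps (fun i => (W.st i).shade) := by
  intro h
  obtain ⟨t, -, ht⟩ := h 0
  exact not_jumpAt hp hroot W t ht

/-- **The shade is ANTITONE along every forced walk from a root** (every prime, every `e`). [new] [folklore] -/
theorem shade_antitone (hp : p.Prime) (hroot : IsRoot (p ^ e) s₀) (W : ForcedWalk (p ^ e) s₀) :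
    Antitone (fun i => (W.st i).shade) :=
  antitone_nat_of_succ_le fun n => shade_succ_le_shade hp hroot W n

/-- … and therefore EVENTUALLY CONSTANT: every infinite forced walk is eventually a plateau. [new] [folklore] -/
theorem shade_eventuallyStalls (hp : p.Prime) (hroot : IsRoot (p ^ e) s₀) (W : ForcedWalk (p ^ e) s₀) :
    EventuallyStalls (fun i => (W.st i).shade) :=
  eventuallyStalls_of_not_recurrentJumps _ (not_recurrentJumps hp hroot W)

/-- The shade never exceeds its initial value `ord F₀` (the root is boundary-free). [new] [folklore] -/
theorem shade_le_shade_zero (hp : p.Prime) (hroot : IsRoot (p ^ e) s₀) (W : ForcedWalk (p ^ e) s₀) (n : ℕ) :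
    (W.st n).shade ≤ (W.st 0).shade :=
  shade_antitone hp hroot W (Nat.zero_le n)

end Jumps

/-! ## §4 The cut: the jump half of 31770 is DECIDED; `DefectWalksDeep ⟺ NoPlateauWalksDeep` -/

/-- **`NoRecurrentJumpWalksDeep` HOLDS** (tree `ItineraryCutClasses` :291, there UNDECIDED·IDEA-NEEDED). [new] [folklore] -/
theorem noRecurrentJumpWalksDeep_holds : NoRecurrentJumpWalksDeep := by
  intro p hp e _ K _ _ _ _ s₀ hroot W _ hrec
  exact not_recurrentJumps hp hroot W hrec

/-- The boundary form holds too (tree `noRecurrentJump_iff_boundary`). [new] [folklore] -/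
theorem noRecurrentBoundaryJumpWalksDeep_holds : NoRecurrentBoundaryJumpWalksDeep :=
  noRecurrentJump_iff_boundary.mp noRecurrentJumpWalksDeep_holds

/-- **The route aside `MaxContactCut.ICNoRecurrentJumpDeep` CLOSES (proved).** [new] [folklore] -/
theorem icNoRecurrentJumpDeep_holds : MaxContactCut.ICNoRecurrentJumpDeep :=
  MaxContactCutItineraryCut.icNoRecurrentJumpDeep_iff.mpr noRecurrentJumpWalksDeep_holds

/-- **THE CUT (EXACT): the deep E-format class is the plateau class.** [new] [folklore] -/
theorem defectDeep_iff_noPlateau : DefectWalksTerminateDeep ↔ NoPlateauWalksDeep :=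
  ⟨noPlateau_of_deep, fun h => deep_of_itinerary h noRecurrentJumpWalksDeep_holds⟩

/-- The same BY NAME on the route: item 31770 `MaxContactCut.DefectWalksDeep ⟺ NoPlateauWalksDeep`. [new] [folklore] -/
theorem defectWalksDeep_iff_noPlateau : MaxContactCut.DefectWalksDeep ↔ NoPlateauWalksDeep :=
  MaxContactCutTightDefect.defectWalksDeep_iff.trans defectDeep_iff_noPlateau

/-- … and with the route's own aside name `MaxContactCut.ICNoPlateauDeep`. [new] [folklore] -/
theorem defectWalksDeep_iff_icNoPlateau : MaxContactCut.DefectWalksDeep ↔ MaxContactCut.ICNoPlateauDeep :=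
  defectWalksDeep_iff_noPlateau.trans MaxContactCutItineraryCut.icNoPlateauDeep_iff.symm

/-- `closes`-shaped kernel for the host: the ONE residual implies 31770. [new] [folklore] -/
theorem closes (h : NoPlateauWalksDeep) : MaxContactCut.DefectWalksDeep :=
  defectWalksDeep_iff_noPlateau.mpr h

end Summit.ResolutionOfSingularities.ResolutionOfSingularities.Theorems.NoJump
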